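import Mathlib.Analysis.Complex.Polynomial.Basic
import Mathlib.Algebra.MvPolynomial.Nilpotent
import Literature.Computability.AlgebraicComplexity.DeterminantalComplexityProofs
import Literature.Computability.AlgebraicComplexity.MignonRessayreBound
import Literature.Computability.AlgebraicComplexity.PermanentIrreducible

/-! # Crux `UniqStep` (stmt-ValiantsHypothesis-17834), line `Sketch` — stub `stub_optimalStructure`:
# structure of optimal honest projections of the permanent (scaling and full indecomposability)

WHAT. Two structural facts about Valiant projections of `per_N = perPoly (Fin N) ℂ` (`N ≥ 3`) onto the
generic determinant (`IsDetProjection f m`: `f = det A` for an `m × m` matrix `A` all of whose cells are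
a variable `X v` or a constant `C c`; `detProjectionComplexity f = sInf {m | IsDetProjection f m}`):

* (a) SCALING (`isDetProjection_perPoly_of_smul`): if `c • per_N` (`c ≠ 0`) is a projection of `DET_m`
  then so is `per_N`. For `m ≠ N` divide every constant cell by `μ` and keep the variable cells, where
  `μ ≠ 0` solves `μ ^ m = c · μ ^ N` (a complex root): the new matrix is `μ⁻¹ · A(μ x)`, of determinant
  `μ^{-m} · c · μ^N · per_N = per_N` by homogeneity (`aeval_C_mul_X_perPoly`). For `m = N` the
  hypothesis is void: dividing one row by `c` gives an affine representation of `per_N` of size `N`,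
  and Mignon–Ressayre (`sq_le_two_mul_of_hasDetRepr_perPoly`) gives `N² ≤ 2N`, impossible for `N ≥ 3`.
* (b) FULL INDECOMPOSABILITY (`card_add_card_lt_of_zero_block`): an honest matrix `A` of the optimal
  size `p = pdc(per_N)` with `det A = per_N` has no zero block on rows `R ≠ ∅` and columns `C ≠ ∅` with
  `|R| + |C| ≥ p`. If `|R| + |C| > p` every term of the Leibniz expansion vanishes
  (`det_eq_zero_of_zero_block`, pigeonhole), so `det A = 0 ≠ per_N`. If `|R| + |C| = p`, after
  permuting rows and columns the matrix is block upper triangular (Frobenius–König), so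
  `± det A = det B₁ · det B₂` for the two honest diagonal blocks of sizes `|C|`, `|R|` `< p`
  (`exists_det_factor_of_zero_block`); `per_N` is irreducible (`perPoly_irreducible`), so one factor
  is a non-zero constant and the other block is a projection of a non-zero multiple of `per_N` of
  size `< p`, contradicting (a) and the minimality of `pdc`.

WHY. This is stub S2 of the line: hypothesis `h2` of the bet `stub_symForced` (stability method,
step 0) in the composition `UniqStep_of`.

SOURCE. Folklore (Frobenius–König; rescaling of homogeneous polynomials); T. Mignon, N. Ressayre,
*A quadratic bound for the determinant and permanent problem*, IMRN 2004, Thm. 1.1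
(key `MignonRessayre2004`, used through the tree's `sq_le_two_mul_of_hasDetRepr_perPoly`);
J. von zur Gathen, *Permanent and determinant*, Linear Algebra Appl. 96 (1987), Thm. 3.4
(irreducibility of the permanent, the tree's `perPoly_irreducible`).
-/

-- D-0017 layout: Sub = Summit for this single-conjunct summit, so the namespace repeats a component.
set_option linter.dupNamespace false

namespace Summit.ValiantsHypothesis.ValiantsHypothesis.Theorems.ProjectionStabilityUniqStep

open MvPolynomial
open scoped BigOperators Matrix
open Literature.Computability.AlgebraicComplexity

noncomputable section

/-! ### Honest matrices and projections of the determinant -/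

/-- An honest square matrix (every cell a variable or a constant) indexed by any finite type `ι`
exhibits its determinant as a projection of `DET_{|ι|}` (reindex along `ι ≃ Fin |ι|`;
`aeval a DET = det (a (i, j))` by `AlgHom.map_det`). [folklore] -/
theorem isDetProjection_det_of_isPure {k : Type*} [CommRing k] {σ ι : Type*} [Fintype ι]
    [DecidableEq ι] (B : Matrix ι ι (MvPolynomial σ k))
    (hB : ∀ i j, (∃ v, B i j = X v) ∨ ∃ c, B i j = C c) :
    IsDetProjection B.det (Fintype.card ι) := by
  refine ⟨fun p => B ((Fintype.equivFin ι).symm p.1) ((Fintype.equivFin ι).symm p.2),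
    fun p => hB _ _, ?_⟩
  have hmap : (aeval fun p : Fin (Fintype.card ι) × Fin (Fintype.card ι) =>
      B ((Fintype.equivFin ι).symm p.1) ((Fintype.equivFin ι).symm p.2)).mapMatrix
      (Matrix.mvPolynomialX (Fin (Fintype.card ι)) (Fin (Fintype.card ι)) k) =
      B.submatrix (Fintype.equivFin ι).symm (Fintype.equivFin ι).symm := by
    ext i j
    simp [Matrix.mvPolynomialX_apply]
  rw [detPoly, AlgHom.map_det, hmap, Matrix.det_submatrix_equiv_self]

/-- The substitution `a ↦ (a (i, j))ᵢⱼ` turns `aeval a DET_m` into an honest determinant: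
`(aeval a) (X_{ij}) = (a (i, j))`. [folklore] -/
theorem aeval_mapMatrix_mvPolynomialX {k : Type*} [CommRing k] {σ : Type*} {m : ℕ}
    (a : Fin m × Fin m → MvPolynomial σ k) :
    (aeval a).mapMatrix (Matrix.mvPolynomialX (Fin m) (Fin m) k) = Matrix.of fun i j => a (i, j) := by
  ext i j
  simp [Matrix.mvPolynomialX_apply]

/-! ### (a) Scaling -/

/-- Homogeneity of the generic permanent under the scalar substitution `X v ↦ μ · X v`:
`per(μ X) = μ ^ |n| · per(X)` (every term of the permanent is a product of `|n|` variables).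
[folklore] -/
theorem aeval_C_mul_X_perPoly {k : Type*} [CommRing k] {n : Type*} [Fintype n] [DecidableEq n]
    (μ : k) :
    aeval (fun v : n × n => C μ * X v) (perPoly n k) = C (μ ^ Fintype.card n) * perPoly n k := by
  simp only [perPoly, Matrix.permanent, map_sum, map_prod, Finset.mul_sum]
  refine Finset.sum_congr rfl fun π _ => ?_
  simp only [Matrix.mvPolynomialX_apply, aeval_X, Finset.prod_mul_distrib, Finset.prod_const,
    Finset.card_univ, map_pow]

/-- RESCALING A PROJECTION: if `c • per_N = det A` for an honest `m × m` matrix `A` and `μ ≠ 0`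
satisfies `μ ^ m = c · μ ^ N`, then the honest matrix `μ⁻¹ · A(μ x)` (variable cells unchanged,
constant cells divided by `μ`) has determinant `μ^{-m} · (c · μ^N) · per_N = per_N`. [folklore] -/
theorem isDetProjection_perPoly_of_smul_of_root {N m : ℕ} {c μ : ℂ} (hμ : μ ≠ 0)
    (hcμ : μ ^ m = c * μ ^ N) (h : IsDetProjection (c • perPoly (Fin N) ℂ) m) :
    IsDetProjection (perPoly (Fin N) ℂ) m := by
  obtain ⟨a, ha, heq⟩ := h
  set φ : MvPolynomial (Fin N × Fin N) ℂ →ₐ[ℂ] MvPolynomial (Fin N × Fin N) ℂ :=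
    aeval fun v => C μ * X v with hφ
  refine ⟨fun p => C μ⁻¹ * φ (a p), fun p => ?_, ?_⟩
  · show (∃ j, C μ⁻¹ * φ (a p) = X j) ∨ ∃ d, C μ⁻¹ * φ (a p) = C d
    rcases ha p with ⟨j, hj⟩ | ⟨d, hd⟩
    · refine Or.inl ⟨j, ?_⟩
      rw [hj, hφ, aeval_X, ← mul_assoc, ← map_mul, inv_mul_cancel₀ hμ, map_one, one_mul]
    · refine Or.inr ⟨μ⁻¹ * d, ?_⟩
      rw [hd, hφ, aeval_C, algebraMap_eq, map_mul]
  · rw [detPoly, AlgHom.map_det, aeval_mapMatrix_mvPolynomialX] at heq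
    rw [detPoly, AlgHom.map_det, aeval_mapMatrix_mvPolynomialX]
    have hM : (Matrix.of fun i j => C μ⁻¹ * φ (a (i, j))) =
        (C μ⁻¹ : MvPolynomial (Fin N × Fin N) ℂ) • φ.mapMatrix (Matrix.of fun i j => a (i, j)) := by
      ext i j
      simp only [Matrix.of_apply, Matrix.smul_apply, smul_eq_mul, AlgHom.mapMatrix_apply,
        Matrix.map_apply]
    have hper : φ (perPoly (Fin N) ℂ) = C (μ ^ N) * perPoly (Fin N) ℂ := by
      rw [hφ, aeval_C_mul_X_perPoly, Fintype.card_fin]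
    rw [hM, Matrix.det_smul, ← AlgHom.map_det, ← heq, Fintype.card_fin, map_smul, hper,
      smul_eq_C_mul, ← mul_assoc, ← mul_assoc, ← map_pow, ← map_mul, ← map_mul, mul_assoc, ← hcμ,
      ← mul_pow, inv_mul_cancel₀ hμ, one_pow, map_one, one_mul]

/-- The exponent equation of the rescaling has a non-zero complex solution as soon as `m ≠ N`:
`μ ^ (m - N) = c` for `m > N`, `μ ^ (N - m) = c⁻¹` for `m < N` (`ℂ` is algebraically closed).
[folklore] -/
theorem exists_scaling_root {N m : ℕ} (hmN : m ≠ N) {c : ℂ} (hc : c ≠ 0) :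
    ∃ μ : ℂ, μ ≠ 0 ∧ μ ^ m = c * μ ^ N := by
  rcases Nat.lt_or_gt_of_ne hmN with hlt | hgt
  · obtain ⟨μ, hμ⟩ := IsAlgClosed.exists_pow_nat_eq c⁻¹ (Nat.sub_pos_of_lt hlt)
    have hμ0 : μ ≠ 0 := by
      rintro rfl
      rw [zero_pow (Nat.sub_ne_zero_of_lt hlt)] at hμ
      exact inv_ne_zero hc hμ.symm
    refine ⟨μ, hμ0, ?_⟩
    calc μ ^ m = c * μ ^ (N - m) * μ ^ m := by rw [hμ, mul_inv_cancel₀ hc, one_mul]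
      _ = c * μ ^ N := by rw [mul_assoc, ← pow_add, Nat.sub_add_cancel hlt.le]
  · obtain ⟨μ, hμ⟩ := IsAlgClosed.exists_pow_nat_eq c (Nat.sub_pos_of_lt hgt)
    have hμ0 : μ ≠ 0 := by
      rintro rfl
      rw [zero_pow (Nat.sub_ne_zero_of_lt hgt)] at hμ
      exact hc hμ.symm
    refine ⟨μ, hμ0, ?_⟩
    rw [← hμ, ← pow_add, Nat.sub_add_cancel hgt.le]

/-- Dividing one row of an affine determinantal representation of `c · f` (`c ≠ 0`, size `m ≥ 1`) by
`c` gives an affine determinantal representation of `f` of the same size. [folklore] -/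
theorem hasDetRepr_of_hasDetRepr_C_mul {σ : Type*} {f : MvPolynomial σ ℂ} {c : ℂ} (hc : c ≠ 0)
    {m : ℕ} (hm : 0 < m) (h : HasDetRepr (C c * f) m) : HasDetRepr f m := by
  obtain ⟨A, hA, hdet⟩ := h
  refine ⟨A.updateRow ⟨0, hm⟩ ((C c⁻¹ : MvPolynomial σ ℂ) • A ⟨0, hm⟩), fun i j => ?_, ?_⟩
  · rw [Matrix.updateRow_apply]
    split_ifs
    · rw [Pi.smul_apply, smul_eq_mul]
      exact (totalDegree_mul _ _).trans (by rw [totalDegree_C, zero_add]; exact hA _ _)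
    · exact hA i j
  · rw [Matrix.det_updateRow_smul, Matrix.updateRow_eq_self, hdet, ← mul_assoc, ← map_mul,
      inv_mul_cancel₀ hc, map_one, one_mul]

/-- THE CASE `m = N` IS VOID: `c • per_N` (`c ≠ 0`, `N ≥ 3`) is a projection of no `DET_N`, since it
would give an affine determinantal representation of `per_N` of size `N` and Mignon–Ressayre's bound
`N² ≤ 2 · N` fails for `N ≥ 3`. [cite: MignonRessayre2004, Thm. 1.1] -/
theorem not_isDetProjection_smul_perPoly_self {N : ℕ} (hN : 3 ≤ N) {c : ℂ} (hc : c ≠ 0) :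
    ¬ IsDetProjection (c • perPoly (Fin N) ℂ) N := by
  intro h
  have h1 : HasDetRepr (perPoly (Fin N) ℂ) N := by
    refine hasDetRepr_of_hasDetRepr_C_mul hc (by omega) ?_
    rw [← smul_eq_C_mul]
    exact IsDetProjection.hasDetRepr_holds h
  obtain ⟨n, rfl⟩ : ∃ n, N = n + 3 := ⟨N - 3, by omega⟩
  have := sq_le_two_mul_of_hasDetRepr_perPoly h1
  nlinarith [sq_nonneg n]

/-- **(a) SCALING.** For `N ≥ 3` and `c ≠ 0`, if `c • per_N` is a projection of `DET_m` then so is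
`per_N` (`m = N` is void by Mignon–Ressayre; for `m ≠ N` rescale by a root of `μ ^ m = c · μ ^ N`).
[folklore] -/
theorem isDetProjection_perPoly_of_smul {N m : ℕ} {c : ℂ} (hN : 3 ≤ N) (hc : c ≠ 0)
    (h : IsDetProjection (c • perPoly (Fin N) ℂ) m) : IsDetProjection (perPoly (Fin N) ℂ) m := by
  rcases eq_or_ne m N with rfl | hmN
  · exact absurd h (not_isDetProjection_smul_perPoly_self hN hc)
  · obtain ⟨μ, hμ, hcμ⟩ := exists_scaling_root hmN hc
    exact isDetProjection_perPoly_of_smul_of_root hμ hcμ h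

/-! ### (b) Frobenius–König and full indecomposability -/

/-- A ZERO BLOCK WITH `|R| + |C| > |ι|` KILLS THE DETERMINANT: for every permutation `σ` the sets
`σ(C)` and `R` meet (pigeonhole), so every term of the Leibniz expansion has a vanishing factor.
[folklore] -/
theorem det_eq_zero_of_zero_block {K : Type*} [CommRing K] {ι : Type*} [Fintype ι] [DecidableEq ι]
    (A : Matrix ι ι K) (R C : Finset ι) (hzero : ∀ i ∈ R, ∀ j ∈ C, A i j = 0)
    (hcard : Fintype.card ι < R.card + C.card) : A.det = 0 := by
  rw [Matrix.det_apply']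
  refine Finset.sum_eq_zero fun σ _ => ?_
  obtain ⟨i, hiC, hσi⟩ : ∃ i ∈ C, σ i ∈ R := by
    by_contra hcon
    have h1 : (C.image σ).card = C.card := Finset.card_image_of_injective _ σ.injective
    have h2 : C.image σ ⊆ Rᶜ := by
      intro x hx
      obtain ⟨i, hi, rfl⟩ := Finset.mem_image.mp hx
      exact Finset.mem_compl.mpr fun hσ => hcon ⟨i, hi, hσ⟩
    have h3 := Finset.card_le_card h2
    rw [h1, Finset.card_compl] at h3
    have h4 : R.card ≤ Fintype.card ι := R.card_le_univ
    omega
  exact mul_eq_zero_of_right _ (Finset.prod_eq_zero (Finset.mem_univ i) (hzero _ hσi _ hiC))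

/-- FROBENIUS–KÖNIG FACTORISATION: if `A` has a zero block on rows `R` and columns `C` with
`|R| + |C| = |ι|`, then after permuting rows (`Rᶜ` first, then `R`) and columns (`C` first, then `Cᶜ`)
the matrix is block upper triangular, so `± det A = det B₁ · det B₂` for the diagonal blocks
`B₁ = A[Rᶜ, C]` and `B₂ = A[R, Cᶜ]` (both submatrices of `A`, of sizes `|C|` and `|ι| - |C|`;
`Matrix.det_permute`, `Matrix.det_fromBlocks_zero₂₁`). [folklore] -/
theorem exists_det_factor_of_zero_block {K : Type*} [CommRing K] {ι : Type*} [Fintype ι]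
    [DecidableEq ι] (A : Matrix ι ι K) (R C : Finset ι)
    (hzero : ∀ i ∈ R, ∀ j ∈ C, A i j = 0) (hcard : R.card + C.card = Fintype.card ι) :
    ∃ (r₁ c₁ : {j // j ∈ C} → ι) (r₂ c₂ : {j // j ∉ C} → ι) (ε : ℤˣ),
      ((ε : ℤ) : K) * A.det = (A.submatrix r₁ c₁).det * (A.submatrix r₂ c₂).det := by
  have hc₁ : Fintype.card {j // j ∈ C} = Fintype.card {i // i ∉ R} := by
    rw [Fintype.card_subtype_compl, Fintype.card_coe, Fintype.card_coe]; omega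
  have hc₂ : Fintype.card {j // j ∉ C} = Fintype.card {i // i ∈ R} := by
    rw [Fintype.card_subtype_compl, Fintype.card_coe, Fintype.card_coe]; omega
  set g₁ : {j // j ∈ C} ≃ {i // i ∉ R} := Fintype.equivOfCardEq hc₁
  set g₂ : {j // j ∉ C} ≃ {i // i ∈ R} := Fintype.equivOfCardEq hc₂
  set eR : {i // i ∉ R} ⊕ {i // i ∈ R} ≃ ι :=
    (Equiv.sumComm _ _).trans (Equiv.sumCompl fun i => i ∈ R) with heR
  set κ : {j // j ∈ C} ⊕ {j // j ∉ C} ≃ ι := Equiv.sumCompl fun j => j ∈ C with hκ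
  set ρ : {j // j ∈ C} ⊕ {j // j ∉ C} ≃ ι := (g₁.sumCongr g₂).trans eR with hρ
  set M : Matrix ({j // j ∈ C} ⊕ {j // j ∉ C}) ({j // j ∈ C} ⊕ {j // j ∉ C}) K :=
    A.submatrix ρ κ with hM
  have hρ₂ : ∀ x, (ρ (Sum.inr x) : ι) ∈ R := fun x => by
    rw [hρ, heR, Equiv.trans_apply, Equiv.sumCongr_apply, Sum.map_inr, Equiv.trans_apply,
      Equiv.sumComm_apply, Sum.swap_inr, Equiv.sumCompl_apply_inl]
    exact (g₂ x).2
  have hκ₁ : ∀ y, (κ (Sum.inl y) : ι) ∈ C := fun y => by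
    rw [hκ, Equiv.sumCompl_apply_inl]
    exact y.2
  have h21 : M.toBlocks₂₁ = 0 := by
    ext x y
    exact hzero _ (hρ₂ x) _ (hκ₁ y)
  have hdetM : M.det = M.toBlocks₁₁.det * M.toBlocks₂₂.det := by
    conv_lhs => rw [← Matrix.fromBlocks_toBlocks M]
    rw [h21, Matrix.det_fromBlocks_zero₂₁]
  have hperm : M = (A.submatrix κ κ).submatrix (ρ.trans κ.symm) id := by
    ext x y
    simp [hM]
  have hsign : M.det = ((Equiv.Perm.sign (ρ.trans κ.symm) : ℤ) : K) * A.det := by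
    rw [hperm, Matrix.det_permute, Matrix.det_submatrix_equiv_self]
  refine ⟨fun x => ρ (Sum.inl x), fun y => κ (Sum.inl y), fun x => ρ (Sum.inr x),
    fun y => κ (Sum.inr y), Equiv.Perm.sign (ρ.trans κ.symm), ?_⟩
  rw [← hsign, hdetM]
  rfl

/-- ONE UNIT FACTOR MAKES THE OTHER BLOCK A SMALLER PROJECTION: if `det B₁ · det B₂ = c · per_N`
(`c ≠ 0`, `N ≥ 3`) with `B₂` honest and `det B₁` a unit, then `det B₁` is a non-zero constant `u`
(`MvPolynomial.isUnit_iff_eq_C_of_isReduced`), `det B₂ = (u⁻¹ c) • per_N` is a projection of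
`DET_{|ι₂|}`, hence so is `per_N` by (a), and `pdc(per_N) ≤ |ι₂|`. [folklore] -/
theorem detProjectionComplexity_le_card_of_isUnit {N : ℕ} (hN : 3 ≤ N) {ι₁ ι₂ : Type*}
    [Fintype ι₁] [DecidableEq ι₁] [Fintype ι₂] [DecidableEq ι₂]
    (B₁ : Matrix ι₁ ι₁ (MvPolynomial (Fin N × Fin N) ℂ))
    (B₂ : Matrix ι₂ ι₂ (MvPolynomial (Fin N × Fin N) ℂ))
    (hB₂ : ∀ i j, (∃ v, B₂ i j = X v) ∨ ∃ c, B₂ i j = C c) {c : ℂ} (hc : c ≠ 0)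
    (h : B₁.det * B₂.det = C c * perPoly (Fin N) ℂ) (hu : IsUnit B₁.det) :
    detProjectionComplexity (perPoly (Fin N) ℂ) ≤ Fintype.card ι₂ := by
  obtain ⟨u, hu, hB₁u⟩ := isUnit_iff_eq_C_of_isReduced.mp hu
  have hu0 : u ≠ 0 := hu.ne_zero
  have hdet₂ : B₂.det = (u⁻¹ * c) • perPoly (Fin N) ℂ := by
    rw [smul_eq_C_mul, map_mul, mul_assoc, ← h, hB₁u, ← mul_assoc, ← map_mul, inv_mul_cancel₀ hu0,
      map_one, one_mul]
  have hproj := isDetProjection_det_of_isPure B₂ hB₂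
  rw [hdet₂] at hproj
  exact Nat.sInf_le (isDetProjection_perPoly_of_smul hN (mul_ne_zero (inv_ne_zero hu0) hc) hproj)

/-- **(b) FULL INDECOMPOSABILITY of optimal honest projections.** An honest matrix of the optimal
size `p = pdc(per_N)` (`N ≥ 3`) with `det = per_N` has no zero block on non-empty rows `R` and
columns `C` with `|R| + |C| ≥ p`: `|R| + |C| > p` forces `det = 0 ≠ per_N`
(`det_eq_zero_of_zero_block`), and `|R| + |C| = p` factors `± per_N = det B₁ · det B₂` through honest
blocks of sizes `|C|, |R| < p` (`exists_det_factor_of_zero_block`); by irreducibility of `per_N` one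
factor is a unit, and the other block projects a non-zero multiple of `per_N` in size `< p`,
contradicting (a) and the minimality of `pdc` (`detProjectionComplexity_le_card_of_isUnit`).
[folklore] -/
theorem card_add_card_lt_of_zero_block {N : ℕ} (hN : 3 ≤ N)
    (A : Matrix (Fin (detProjectionComplexity (perPoly (Fin N) ℂ)))
      (Fin (detProjectionComplexity (perPoly (Fin N) ℂ))) (MvPolynomial (Fin N × Fin N) ℂ))
    (hA : ∀ i j, (∃ v, A i j = X v) ∨ ∃ c, A i j = C c) (hdet : A.det = perPoly (Fin N) ℂ)
    (R S : Finset (Fin (detProjectionComplexity (perPoly (Fin N) ℂ)))) (hR : R.Nonempty)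
    (hS : S.Nonempty) (hzero : ∀ i ∈ R, ∀ j ∈ S, A i j = 0) :
    R.card + S.card < detProjectionComplexity (perPoly (Fin N) ℂ) := by
  haveI : NeZero N := ⟨by omega⟩
  by_contra hge
  rw [not_lt] at hge
  have hper0 : perPoly (Fin N) ℂ ≠ 0 := (perPoly_irreducible (n := Fin N) (R := ℂ)).ne_zero
  rcases hge.lt_or_eq with hlt | heq
  · have h0 := det_eq_zero_of_zero_block A R S hzero (by rwa [Fintype.card_fin])
    rw [hdet] at h0
    exact hper0 h0
  · obtain ⟨r₁, c₁, r₂, c₂, ε, hfac⟩ :=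
      exists_det_factor_of_zero_block A R S hzero (by rw [Fintype.card_fin]; exact heq.symm)
    have hε : ((ε : ℤ) : ℂ) ≠ 0 := Int.cast_ne_zero.mpr ε.ne_zero
    have hfac' : (A.submatrix r₁ c₁).det * (A.submatrix r₂ c₂).det =
        C ((ε : ℤ) : ℂ) * perPoly (Fin N) ℂ := by
      rw [← hfac, hdet, map_intCast]
    have hB₁ : ∀ i j, (∃ v, A.submatrix r₁ c₁ i j = X v) ∨ ∃ c, A.submatrix r₁ c₁ i j = C c :=
      fun i j => hA _ _
    have hB₂ : ∀ i j, (∃ v, A.submatrix r₂ c₂ i j = X v) ∨ ∃ c, A.submatrix r₂ c₂ i j = C c :=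
      fun i j => hA _ _
    have hRC : R.card ≤ detProjectionComplexity (perPoly (Fin N) ℂ) := by
      simpa using R.card_le_univ
    have hSC : S.card ≤ detProjectionComplexity (perPoly (Fin N) ℂ) := by
      simpa using S.card_le_univ
    have hRpos := hR.card_pos
    have hSpos := hS.card_pos
    rcases isUnit_or_isUnit_of_mul_eq_C_mul_perPoly hε hfac' with h1 | h2
    · have hle := detProjectionComplexity_le_card_of_isUnit hN _ _ hB₂ hε hfac' h1
      rw [Fintype.card_subtype_compl, Fintype.card_coe, Fintype.card_fin] at hle
      omega
    · have hle := detProjectionComplexity_le_card_of_isUnit hN _ _ hB₁ hε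
        (by rw [mul_comm]; exact hfac') h2
      rw [Fintype.card_coe] at hle
      omega

/-! ### The registered stub -/

/-- **STUB S2** of line `Sketch` of crux `UniqStep`: structure of optimal honest projections of the
permanent — (a) scaling: `IsDetProjection (c • per_N) m → IsDetProjection per_N m` for `N ≥ 3`,
`c ≠ 0`; (b) full indecomposability: an honest matrix of the optimal size `pdc(per_N)` with
`det = per_N` has no zero block on non-empty rows `R` and columns `C` with `|R| + |C| ≥ pdc(per_N)`
(Frobenius–König, irreducibility of the permanent, (a), minimality of `pdc`). [folklore] -/
theorem stub_optimalStructure :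
    (∀ (N m : ℕ) (c : ℂ), 3 ≤ N → c ≠ 0 →
        IsDetProjection (c • perPoly (Fin N) ℂ) m → IsDetProjection (perPoly (Fin N) ℂ) m) ∧
    (∀ N : ℕ, 3 ≤ N →
      ∀ A : Matrix (Fin (detProjectionComplexity (perPoly (Fin N) ℂ)))
          (Fin (detProjectionComplexity (perPoly (Fin N) ℂ))) (MvPolynomial (Fin N × Fin N) ℂ),
        (∀ i j, (∃ v, A i j = X v) ∨ ∃ c, A i j = C c) → A.det = perPoly (Fin N) ℂ →
        ∀ R C : Finset (Fin (detProjectionComplexity (perPoly (Fin N) ℂ))), R.Nonempty → C.Nonempty →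
          (∀ i ∈ R, ∀ j ∈ C, A i j = 0) →
          R.card + C.card < detProjectionComplexity (perPoly (Fin N) ℂ)) :=
  ⟨fun _ _ _ hN hc h => isDetProjection_perPoly_of_smul hN hc h,
    fun _ hN A hA hdet R C hR hC hzero => card_add_card_lt_of_zero_block hN A hA hdet R C hR hC hzero⟩

end

end Summit.ValiantsHypothesis.ValiantsHypothesis.Theorems.ProjectionStabilityUniqStep
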